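import Summits.QuantumFields.YangMills.Theorems.ColdStartUniversalityLindebergSwapRegularContinuity
import Summits.QuantumFields.YangMills.Theorems.ColdStartUniversalityLatticeLangevinStochasticContinuity
import HarnessLib

/-!
# Crux `ColdStartContinuumCauchy` (stmt-QuantumFields-24810, route `ColdStartUniversality`), LINE 3 «lindeberg_swap»:
# THE COLD NEIGHBOURHOOD, I — UNIFORM SMALL-FIELD MODULUS OF THE DISCREPANCY NEAR THE COLD CONFIGURATION

Helper file (seat `ym-line-csu-p1`, g9; `--supports stmt-QuantumFields-24810`).  Brick (v1) of the proof plan for the registered rung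
`stub_shortWindowSwap` (plan v4 on the crux; the regime `t₀ < ε' t₁` of the assembly).  `…LindebergSwapSmallFieldContinuity` gave
continuity of Bałaban's guarded averaging AT the cold configuration `1`; here it is made UNIFORM on a neighbourhood: the iterated
averaging is continuous on an OPEN set around `1` (interior of the nested small-loop classes), hence — compactness of a closed
Hilbert–Schmidt ball inside it — the discrepancy majorant has a uniform modulus there:

* `exists_modulus_of_continuousOn` — abstract: a function continuous on `K × K` (`K` compact) and vanishing on the diagonal is `< η`
  at pairs of `K` that are `d`-close, for any continuous `d` vanishing only on the diagonal;
* `hsDist_le_two_mul_add` — the quasi-triangle inequality `D(a,c) ≤ 2D(a,b) + 2D(b,c)` of the squared Hilbert–Schmidt «distance»;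
* `exists_open_one_continuousOn_avgField` — an open set around `1` on which all `avgField K j`, `j ≤ K`, are continuous;
* `exists_coarse_cold_modulus` — `∃ r ρ > 0`: `D(u,1) ≤ r`, `D(v,1) ≤ r`, `D(v,u) < ρ ⇒ wdisc_K(v,u) < η`.
The fine-level modulus through `stepDown` and the two regime-B expectation estimates follow in part II.
THEOREMS ONLY, no sorry.  HONEST FRAMING: plumbing; no crux, rung or summit is proved; the Yang–Mills mass gap is NOT proved.
-/

set_option autoImplicit false

noncomputable section

namespace Summit.QuantumFields.YangMills.Cruxes.ColdStartContinuumCauchy.LindebergSwap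

open scoped BigOperators Topology NNReal ENNReal
open MeasureTheory Filter Set Function
open Literature.MathematicalPhysics.QuantumFieldTheory
open Literature.MathematicalPhysics.QuantumFieldTheory.Balaban1983to89
open Literature.MathematicalPhysics.QuantumLattice
open Literature.MathematicalPhysics.QuantumFieldTheory.Balaban1983to89.BlockAveraging (blockAvg blockAvg_avg avgFun loopHol Idx)
open Summit.QuantumFields.BalabanUV.T4Continuum.SubstrateBlockAvgContinuity
  (NestedSmall continuousOn_iter_blockAvg continuous_dist1_SU smallContinuous_expMeanLogSU)

/-! ## §0 Two abstract tools -/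

/-- **Uniform modulus on a compact set**: if `Φ` is continuous on `K ×ˢ K` (`K` compact, Hausdorff ambient space) with `Φ (y, y) = 0`
on `K`, and `d` is continuous with `d (y, z) = 0 → y = z`, then for every `η > 0` there is `ρ > 0` with `Φ (y, z) < η` whenever
`y, z ∈ K` and `d (y, z) < ρ`. [folklore] -/
theorem exists_modulus_of_continuousOn {X : Type*} [TopologicalSpace X] [T2Space X] {K : Set X} (hK : IsCompact K)
    {Φ d : X × X → ℝ} (hΦ : ContinuousOn Φ (K ×ˢ K)) (h0 : ∀ y ∈ K, Φ (y, y) = 0) (hd : Continuous d)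
    (hdsep : ∀ y z, d (y, z) = 0 → y = z) (hdnn : ∀ p, 0 ≤ d p) {η : ℝ} (hη : 0 < η) :
    ∃ ρ : ℝ, 0 < ρ ∧ ∀ y ∈ K, ∀ z ∈ K, d (y, z) < ρ → Φ (y, z) < η := by
  set S : Set (X × X) := (K ×ˢ K) ∩ Φ ⁻¹' Set.Ici η with hS
  have hKK : IsCompact (K ×ˢ K) := hK.prod hK
  have hSc : IsCompact S := by
    have hcl : IsClosed ((K ×ˢ K) ∩ Φ ⁻¹' Set.Ici η) := hΦ.preimage_isClosed_of_isClosed hKK.isClosed isClosed_Ici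
    exact hKK.of_isClosed_subset hcl Set.inter_subset_left
  by_cases hne : S.Nonempty
  · obtain ⟨p₀, hp₀, hmin⟩ := hSc.exists_isMinOn hne hd.continuousOn
    refine ⟨d p₀, ?_, fun y hy z hz hyz => ?_⟩
    · rcases (hdnn p₀).lt_or_eq with h | h
      · exact h
      · exfalso
        have heq : p₀.1 = p₀.2 := hdsep p₀.1 p₀.2 (by rw [Prod.mk.eta]; exact h.symm)
        have hp : η ≤ Φ p₀ := hp₀.2
        have hz0 : Φ p₀ = 0 := by
          rw [← Prod.mk.eta (p := p₀), heq]; exact h0 _ (by have := hp₀.1.2; exact this)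
        linarith
    · by_contra hcon
      have hmem : (y, z) ∈ S := ⟨⟨hy, hz⟩, not_lt.mp hcon⟩
      exact absurd (hmin hmem) (not_le.mpr hyz)
  · refine ⟨1, one_pos, fun y hy z hz _ => ?_⟩
    by_contra hcon
    exact hne ⟨(y, z), ⟨hy, hz⟩, not_lt.mp hcon⟩

/-- **Quasi-triangle inequality for the squared Hilbert–Schmidt «distance»**: `D(a,c) ≤ 2D(a,b) + 2D(b,c)` (parallelogram bound for
the bilinear form `hsForm`, edge by edge). [folklore] -/
theorem hsDist_le_two_mul_add {N : ℕ} [NeZero N] (a b c : GaugeConfig 3 N G2) :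
    (∑ e, hsForm 2 ((fundamentalRep (Fin 2) (a e) : Matrix (Fin 2) (Fin 2) ℂ) - fundamentalRep (Fin 2) (c e))
        ((fundamentalRep (Fin 2) (a e) : Matrix (Fin 2) (Fin 2) ℂ) - fundamentalRep (Fin 2) (c e))) ≤
      2 * (∑ e, hsForm 2 ((fundamentalRep (Fin 2) (a e) : Matrix (Fin 2) (Fin 2) ℂ) - fundamentalRep (Fin 2) (b e))
        ((fundamentalRep (Fin 2) (a e) : Matrix (Fin 2) (Fin 2) ℂ) - fundamentalRep (Fin 2) (b e))) +
      2 * (∑ e, hsForm 2 ((fundamentalRep (Fin 2) (b e) : Matrix (Fin 2) (Fin 2) ℂ) - fundamentalRep (Fin 2) (c e))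
        ((fundamentalRep (Fin 2) (b e) : Matrix (Fin 2) (Fin 2) ℂ) - fundamentalRep (Fin 2) (c e))) := by
  rw [Finset.mul_sum, Finset.mul_sum, ← Finset.sum_add_distrib]
  refine Finset.sum_le_sum fun e _ => ?_
  set x : Matrix (Fin 2) (Fin 2) ℂ := (fundamentalRep (Fin 2) (a e) : Matrix (Fin 2) (Fin 2) ℂ) - fundamentalRep (Fin 2) (b e)
  set y : Matrix (Fin 2) (Fin 2) ℂ := (fundamentalRep (Fin 2) (b e) : Matrix (Fin 2) (Fin 2) ℂ) - fundamentalRep (Fin 2) (c e)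
  have hxy : (fundamentalRep (Fin 2) (a e) : Matrix (Fin 2) (Fin 2) ℂ) - fundamentalRep (Fin 2) (c e) = x + y := by
    simp only [x, y]; abel
  rw [hxy]
  -- parallelogram: `⟨x+y,x+y⟩ + ⟨x-y,x-y⟩ = 2⟨x,x⟩ + 2⟨y,y⟩`, and `⟨x-y,x-y⟩ ≥ 0`
  have hpar : hsForm 2 (x + y) (x + y) + hsForm 2 (x - y) (x - y) = 2 * hsForm 2 x x + 2 * hsForm 2 y y := by
    simp only [map_add, map_sub, LinearMap.add_apply, LinearMap.sub_apply]
    ring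
  linarith [hsForm_self_nonneg (N := 2) (x - y)]

variable (F : T3ContinuumYM3Torus.T3Family)

/-! ## §1 The coarse cold neighbourhood -/

/-- **An open neighbourhood of the cold configuration on which all block averages `avgField K j`, `j ≤ K`, are continuous.**
[cite: Balaban1987RG1, (0.4) p.253] -/
theorem exists_open_one_continuousOn_avgField (K : ℕ) :
    ∃ O : Set (GaugeConfig 3 ((F.P K).sitesPerDir 0) G2), IsOpen O ∧ (fun _ => (1 : G2)) ∈ O ∧
      ∀ j, j ≤ K → ContinuousOn (avgField F K j) O := by
  have hδ : (avSU).δ / 2 < (avSU).δ := half_lt_self (avSU).δ_pos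
  choose Oj hOj h1j hsubj using fun j : ℕ => exists_open_one_subset_nestedSmall (F.P K) (half_pos (avSU).δ_pos) hδ j
  refine ⟨⋂ j ∈ Finset.range (K + 1), toField F K ⁻¹' Oj j, ?_, ?_, ?_⟩
  · exact isOpen_biInter_finset fun j _ => (hOj j).preimage (continuous_toField F K)
  · simp only [Set.mem_iInter, Set.mem_preimage]
    intro j _
    rw [toField_one]; exact h1j j
  · intro j hj
    have hco : ContinuousOn (Averaging.iter (fun i => (blockAvg (P := F.P K) (j := i) avSU : Averaging (F.P K) i G2)) j) (Oj j) :=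
      (continuousOn_iter_blockAvg avSU continuous_dist1_SU smallContinuous_expMeanLogSU hδ j).mono (hsubj j)
    refine (hco.comp (continuous_toField F K).continuousOn ?_)
    intro u hu
    simp only [Set.mem_iInter, Set.mem_preimage] at hu
    exact hu j (Finset.mem_range.mpr (Nat.lt_succ_of_le hj))

/-- **The coarse cold modulus**: for every `η > 0` there are `r, ρ > 0` such that `wdisc_K(v, u) < η` whenever `u, v` lie in the closed
Hilbert–Schmidt ball of radius `r` around the cold configuration and `D(v, u) < ρ`. [folklore] -/
theorem exists_coarse_cold_modulus (K : ℕ) {η : ℝ} (hη : 0 < η) :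
    ∃ r : ℝ, 0 < r ∧ ∃ ρ : ℝ, 0 < ρ ∧ ∀ u v : GaugeConfig 3 ((F.P K).sitesPerDir 0) G2,
      (∑ e, hsForm 2 ((fundamentalRep (Fin 2) (u e) : Matrix (Fin 2) (Fin 2) ℂ) - fundamentalRep (Fin 2) (1 : G2))
          ((fundamentalRep (Fin 2) (u e) : Matrix (Fin 2) (Fin 2) ℂ) - fundamentalRep (Fin 2) (1 : G2))) ≤ r →
      (∑ e, hsForm 2 ((fundamentalRep (Fin 2) (v e) : Matrix (Fin 2) (Fin 2) ℂ) - fundamentalRep (Fin 2) (1 : G2))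
          ((fundamentalRep (Fin 2) (v e) : Matrix (Fin 2) (Fin 2) ℂ) - fundamentalRep (Fin 2) (1 : G2))) ≤ r →
      (∑ e, hsForm 2 ((fundamentalRep (Fin 2) (v e) : Matrix (Fin 2) (Fin 2) ℂ) - fundamentalRep (Fin 2) (u e))
          ((fundamentalRep (Fin 2) (v e) : Matrix (Fin 2) (Fin 2) ℂ) - fundamentalRep (Fin 2) (u e))) < ρ →
      wdisc F K v u < η := by
  haveI := Summit.QuantumFields.YangMills.Theorems.ColdStartUniversality.secondCountableTopology_su2
  haveI := Summit.QuantumFields.YangMills.Theorems.ColdStartUniversality.borelSpace_config ((F.P K).sitesPerDir 0)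
  obtain ⟨O, hO, h1, hcont⟩ := exists_open_one_continuousOn_avgField F K
  -- a closed Hilbert–Schmidt ball inside `O`
  let D1 : GaugeConfig 3 ((F.P K).sitesPerDir 0) G2 → ℝ := fun u => ∑ e, hsForm 2
      ((fundamentalRep (Fin 2) (u e) : Matrix (Fin 2) (Fin 2) ℂ) - fundamentalRep (Fin 2) (1 : G2))
      ((fundamentalRep (Fin 2) (u e) : Matrix (Fin 2) (Fin 2) ℂ) - fundamentalRep (Fin 2) (1 : G2))
  have hD1c : Continuous D1 := Summit.QuantumFields.YangMills.Theorems.ColdStartUniversality.continuous_hsDist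
    continuous_id (continuous_const (y := fun _ => (1 : G2)))
  obtain ⟨r₀, hr₀, hball⟩ := exists_hsDist_lt_subset hO h1
  let Kc : Set (GaugeConfig 3 ((F.P K).sitesPerDir 0) G2) := {u | D1 u ≤ r₀ / 2}
  have hKcO : Kc ⊆ O := fun u hu => hball u (by have h' : D1 u ≤ r₀ / 2 := hu; exact lt_of_le_of_lt h' (by linarith))
  have hKcpt : IsCompact Kc := (isClosed_le hD1c continuous_const).isCompact
  -- the majorant, continuous on `Kc × Kc`, vanishing on the diagonal
  let Φ : GaugeConfig 3 ((F.P K).sitesPerDir 0) G2 × GaugeConfig 3 ((F.P K).sitesPerDir 0) G2 → ℝ := fun p =>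
    ∑ j ∈ Finset.range (K + 1), ((F.L : ℝ)⁻¹) ^ (K - j) * fieldDistAt F K j (avgField F K j p.2) (avgField F K j p.1)
  have hΦc : ContinuousOn Φ (Kc ×ˢ Kc) := by
    refine continuousOn_finsetSum _ fun j hj => ContinuousOn.mul continuousOn_const ?_
    have hjK : j ≤ K := Nat.lt_succ_iff.mp (Finset.mem_range.mp hj)
    have hfd : Continuous fun q : GaugeField (F.P K) j G2 × GaugeField (F.P K) j G2 => fieldDistAt F K j q.1 q.2 :=
      Summit.QuantumFields.YangMills.Cruxes.WeightedAlmostInvariance.SynchronousShadow.continuous_fieldDistAt F K j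
    have h2 : ContinuousOn (fun p : GaugeConfig 3 ((F.P K).sitesPerDir 0) G2 × GaugeConfig 3 ((F.P K).sitesPerDir 0) G2 =>
        avgField F K j p.2) (Kc ×ˢ Kc) := ((hcont j hjK).mono hKcO).comp continuous_snd.continuousOn fun p hp => hp.2
    have h1' : ContinuousOn (fun p : GaugeConfig 3 ((F.P K).sitesPerDir 0) G2 × GaugeConfig 3 ((F.P K).sitesPerDir 0) G2 =>
        avgField F K j p.1) (Kc ×ˢ Kc) := ((hcont j hjK).mono hKcO).comp continuous_fst.continuousOn fun p hp => hp.1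
    have hpair := h2.prodMk h1'
    have hcomp := hfd.comp_continuousOn hpair
    exact hcomp
  have hΦ0 : ∀ u ∈ Kc, Φ (u, u) = 0 := fun u _ => by
    simp only [Φ, fieldDistAt_self, mul_zero, Finset.sum_const_zero]
  -- the closeness function
  let d : GaugeConfig 3 ((F.P K).sitesPerDir 0) G2 × GaugeConfig 3 ((F.P K).sitesPerDir 0) G2 → ℝ := fun p => ∑ e, hsForm 2
      ((fundamentalRep (Fin 2) (p.2 e) : Matrix (Fin 2) (Fin 2) ℂ) - fundamentalRep (Fin 2) (p.1 e))
      ((fundamentalRep (Fin 2) (p.2 e) : Matrix (Fin 2) (Fin 2) ℂ) - fundamentalRep (Fin 2) (p.1 e))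
  have hdc : Continuous d :=
    Summit.QuantumFields.YangMills.Theorems.ColdStartUniversality.continuous_hsDist continuous_snd continuous_fst
  have hdsep : ∀ y z : GaugeConfig 3 ((F.P K).sitesPerDir 0) G2, d (y, z) = 0 → y = z := fun y z h =>
    (Summit.QuantumFields.YangMills.Theorems.ColdStartUniversality.eq_of_hsDist_eq_zero h).symm
  have hdnn : ∀ p, 0 ≤ d p := fun p => Summit.QuantumFields.YangMills.Theorems.ColdStartUniversality.hsDist_nonneg _ _
  obtain ⟨ρ, hρ, hmod⟩ := exists_modulus_of_continuousOn hKcpt hΦc hΦ0 hdc hdsep hdnn hη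
  refine ⟨r₀ / 2, half_pos hr₀, ρ, hρ, fun u v hu hv huv => ?_⟩
  have hle : wdisc F K v u ≤ Φ (u, v) := by
    simp only [Φ]
    unfold wdisc
    exact Finset.sum_le_sum fun j _ => mul_le_mul_of_nonneg_left (discG_le_fieldDistAt F K j v u)
      (pow_nonneg (inv_nonneg.mpr (Nat.cast_nonneg _)) _)
  exact hle.trans_lt (hmod u hu v hv huv)

end Summit.QuantumFields.YangMills.Cruxes.ColdStartContinuumCauchy.LindebergSwap

end
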